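import Summits.AtomisticToContinuum.BoseEinsteinCondensation.Theorems.BECCutLineWeakDisorderTwoReplicaTransienceBoundFreeGas
import Summits.AtomisticToContinuum.BoseEinsteinCondensation.Theorems.BECCutLineWeakDisorderTwoReplicaTransienceBoundSurvivalFloor
import Literature.MathematicalPhysics.QuantumManyBody.GroundStateFeynmanKacCutLine
import Literature.MathematicalPhysics.QuantumManyBody.GroundStateFeynmanKacDisplacement
import Literature.MathematicalPhysics.QuantumManyBody.OneParticleMarginals
import Literature.MathematicalPhysics.QuantumManyBody.BoseGasThermodynamicLimitRuelle
import Literature.MathematicalPhysics.QuantumManyBody.BoseGasDirichletWall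
import Mathlib.Probability.Distributions.Gaussian.Real
import Summits.AtomisticToContinuum.BoseEinsteinCondensation.Theorems.BECCutLineWeakDisorderTaggedShiftDisplacementGaussian
import HarnessLib

/-!
# Crux `TwoReplicaTransienceBound` (stmt-AtomisticToContinuum-9687), line `tagged-shift-log-harnack`:
# the FREE-GAS row of `stub_taggedDisplacement`

Support file (lead a1, from stub-worker W5). The registered stub `stub_taggedDisplacement`
(`TaggedDisplacementMoments`, Defs file) asks, for EVERY admissible `v`, for Gaussian exponential
moments of the tagged displacement over an early window after the cut under the `2T`-bridge,
uniformly in `n`. This file proves its `v ≡ 0` row with ALL other quantifiers saturated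
(`taggedDisplacement_free` = registered toolbox stub `stub_taggedDisplacementFree`, `ρ₀ = 1`,
`C = max (48/q₀) 9`): factorise the tagged line off the bath, the cross-cut Cauchy–Schwarz bound at
`N = 1` with the Gaussian constant, and `Z₁(T-τ) ≤ (8/q₀) Z₁(T)` (`fkNormSq_one_sub_le`, ladder +
survival floor, valid once `4κ/ρ ≤ L²/960`, i.e. eventually in `n`). The interacting rows are NOT
proved (unpublished n-uniform estimate; Cruxes/…/LeadA1Report.md, work notes displacement_notes.md).
[folklore]
-/


noncomputable section

open MeasureTheory ProbabilityTheory Filter Set Finset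
open scoped ENNReal NNReal Topology BigOperators

namespace Summit.AtomisticToContinuum.BoseEinsteinCondensation.Cruxes.TwoReplicaTransienceBound.TaggedShiftLogHarnack

open Literature.MathematicalPhysics.QuantumManyBody.BoseGas
open Literature.Probability.Process
open Summit.AtomisticToContinuum.BoseEinsteinCondensation.Theses.BECCutLineWeakDisorder

open Summit.AtomisticToContinuum.BoseEinsteinCondensation.Cruxes.TwoReplicaTransienceBound.TracerDecoupling
open Summit.AtomisticToContinuum.BoseEinsteinCondensation.Cruxes.TwoReplicaTransienceBound.TracerDecoupling.TracerFactorisation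

namespace TaggedDisplacement

variable {N : ℕ}

/-! ### The free-gas case of the stub -/

/-- The log-convexity ladder and the survival floor for ONE free line: for `0 ≤ τ ≤ T` and
`4τ ≤ L²/960`, `Z₁(T - τ) ≤ (8/q₀) Z₁(T)`, `q₀ = 1 - 6e⁻⁵` (`Z₁(T-τ)Z₁(2τ) ≤ Z₁(0)Z₁(T)`,
`Z₁(0) ≤ L³`, `Z₁(2τ) ≥ q₀(L/2)³`). -/
theorem fkNormSq_one_sub_le {L T τ : ℝ} (hL : 0 < L) (hτ : 0 ≤ τ) (hτT : τ ≤ T)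
    (h4τ : 2 * (2 * τ) ≤ L ^ 2 / 960) :
    fkNormSq (N := 1) (fun _ => 0) L (T - τ) (fun _ => (1 : ℝ≥0∞)) ≤
      ENNReal.ofReal (8 / (1 - 6 * Real.exp (-5))) *
        fkNormSq (N := 1) (fun _ => 0) L T (fun _ => (1 : ℝ≥0∞)) := by
  have hq := FreeGas.q0_pos
  have h8 : (1 : ℝ) ≤ 8 / (1 - 6 * Real.exp (-5)) := by
    rw [le_div_iff₀ hq]
    have : Real.exp (-5) ≤ 1 := Real.exp_le_one_iff.2 (by norm_num)
    nlinarith [Real.exp_pos (-5)]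
  rcases eq_or_lt_of_le hτ with hτz | hτpos
  · rw [← hτz, sub_zero]
    exact le_mul_of_one_le_left' (ENNReal.one_le_ofReal.2 h8)
  have hv : Measurable (fun _ : ℝ => (0 : ℝ≥0∞)) := measurable_const
  have hl := FreeGas.fkNormSq_ladder (N := 1) hv L hτpos hτT
  have hfl := ShortTime.fkNormSq_free_one_ge hL (by positivity : (0 : ℝ) ≤ 2 * τ) h4τ
  have hZ0 : fkNormSq (N := 1) (fun _ => 0) L 0 (fun _ => (1 : ℝ≥0∞)) ≤ ENNReal.ofReal (L ^ 3) := by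
    refine (Summit.AtomisticToContinuum.BoseEinsteinCondensation.Theorems.CutLineWitness.fkNormSq_one_le
      (N := 1) (fun _ => 0) le_rfl).trans (le_of_eq ?_)
    rw [volume_boxN_one, ENNReal.ofReal_pow hL.le]
  set B : ℝ≥0∞ := ENNReal.ofReal ((1 - 6 * Real.exp (-5)) * (L / 2) ^ 3) with hB
  have hB0 : B ≠ 0 := (ENNReal.ofReal_pos.2 (by positivity)).ne'
  have hBt : B ≠ ⊤ := ENNReal.ofReal_ne_top
  have key : fkNormSq (N := 1) (fun _ => 0) L (T - τ) (fun _ => (1 : ℝ≥0∞)) * B ≤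
      ENNReal.ofReal (8 / (1 - 6 * Real.exp (-5))) *
        fkNormSq (N := 1) (fun _ => 0) L T (fun _ => (1 : ℝ≥0∞)) * B :=
    calc fkNormSq (N := 1) (fun _ => 0) L (T - τ) (fun _ => (1 : ℝ≥0∞)) * B
        ≤ fkNormSq (N := 1) (fun _ => 0) L (T - τ) (fun _ => (1 : ℝ≥0∞)) *
            fkNormSq (N := 1) (fun _ => 0) L (2 * τ) (fun _ => (1 : ℝ≥0∞)) := mul_le_mul' le_rfl hfl
      _ ≤ fkNormSq (N := 1) (fun _ => 0) L 0 (fun _ => (1 : ℝ≥0∞)) *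
            fkNormSq (N := 1) (fun _ => 0) L T (fun _ => (1 : ℝ≥0∞)) := hl
      _ ≤ ENNReal.ofReal (L ^ 3) * fkNormSq (N := 1) (fun _ => 0) L T (fun _ => (1 : ℝ≥0∞)) :=
          mul_le_mul' hZ0 le_rfl
      _ = ENNReal.ofReal (8 / (1 - 6 * Real.exp (-5))) *
            fkNormSq (N := 1) (fun _ => 0) L T (fun _ => (1 : ℝ≥0∞)) * B := by
          have e : L ^ 3 = 8 / (1 - 6 * Real.exp (-5)) * ((1 - 6 * Real.exp (-5)) * (L / 2) ^ 3) := by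
            field_simp
            ring
          rw [e, ENNReal.ofReal_mul (by positivity), hB]
          ring
  exact (ENNReal.mul_le_mul_iff_left hB0 hBt).1 key

/-- **The free-gas case of `TaggedDisplacementMoments`** (`v ≡ 0`; all other quantifiers as in the
stub, `ρ₀ = 1`, `C = max (48/q₀) 9`): factorise the tagged line off the bath
(`lintegral_fkWeight_free_mul_apply_zero`, twice), bound the one-line bridge functional by the
cross-cut Cauchy–Schwarz bound (`crossCut_le` at `N = 1`) with the Gaussian constant
`6e^{9a'²τ} ≤ 6e^{9a²}` (`a' = a/√(τ+1)`), and close with `Z₁(T-τ) ≤ (8/q₀)Z₁(T)`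
(`fkNormSq_one_sub_le`, valid once `4κ/ρ ≤ L²/960`, i.e. eventually in `n`). -/
theorem taggedDisplacement_free (κ a : ℝ) (hκ : 0 < κ) (ha : 0 ≤ a) :
    ∃ ρ₀ : ℝ, 0 < ρ₀ ∧ ∀ ρ : ℝ, 0 < ρ → ρ < ρ₀ → ∃ C : ℝ, 0 < C ∧ ∀ᶠ n : ℕ in atTop,
      ∀ T : ℝ, κ / ρ ≤ T → ∀ τ : ℝ, 0 ≤ τ → τ ≤ κ / ρ →
        ∫⁻ X₀ : Config (n + 1), ∫⁻ ω,
            fkWeight (fun _ => 0) (sideLength ρ (n + 1)) (2 * T) X₀ ω *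
              ENNReal.ofReal (Real.exp (a / Real.sqrt (τ + 1) *
                ‖worldLine X₀ ω (T + τ).toNNReal 0 - worldLine X₀ ω T.toNNReal 0‖))
          ∂wienerPaths (n + 1) ≤
        ENNReal.ofReal (C * Real.exp (C * a ^ 2)) *
          fkNormSq (N := n + 1) (fun _ => 0) (sideLength ρ (n + 1)) T (fun _ => (1 : ℝ≥0∞)) := by
  refine ⟨1, one_pos, fun ρ hρ _ => ?_⟩
  have hq₀pos : 0 < 1 - 6 * Real.exp (-5) := FreeGas.q0_pos
  refine ⟨max (48 / (1 - 6 * Real.exp (-5))) 9, lt_max_of_lt_right (by norm_num), ?_⟩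
  have hκρ : 0 < κ / ρ := div_pos hκ hρ
  have hev : ∀ᶠ n : ℕ in atTop, 3840 * (κ / ρ) + 1 ≤ sideLength ρ (n + 1) :=
    ((tendsto_sideLength_atTop hρ).comp (tendsto_add_atTop_nat 1)).eventually (eventually_ge_atTop _)
  filter_upwards [hev] with n hn T hT τ hτ0 hτκ
  -- scalars
  set L : ℝ := sideLength ρ (n + 1) with hLdef
  have hLpos : 0 < L := sideLength_pos_of_pos hρ (Nat.succ_pos n)
  have hτT : τ ≤ T := hτκ.trans hT
  have hT0 : 0 ≤ T := hτ0.trans hτT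
  have h4τ : 2 * (2 * τ) ≤ L ^ 2 / 960 := by
    have h1 : 3840 * τ ≤ L := by nlinarith
    have h2 : L ≤ L ^ 2 := by nlinarith
    linarith
  set a' : ℝ := a / Real.sqrt (τ + 1) with ha'def
  have ha'0 : 0 ≤ a' := div_nonneg ha (Real.sqrt_nonneg _)
  have ha'2 : 9 * a' ^ 2 * τ ≤ 9 * a ^ 2 := by
    have hs : Real.sqrt (τ + 1) ^ 2 = τ + 1 := Real.sq_sqrt (by linarith)
    have e : a' ^ 2 * (τ + 1) = a ^ 2 := by
      rw [ha'def, div_pow, hs, div_mul_cancel₀ _ (by linarith : (τ + 1) ≠ 0)]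
    nlinarith [sq_nonneg a']
  -- the tagged functional
  set Ψ : (Fin 3 → (ℝ≥0 → ℝ)) → Space := fun ω₀ =>
    WithLp.toLp 2 (fun k => Real.sqrt 2 * brownian (T + τ).toNNReal (ω₀ k)) -
      WithLp.toLp 2 (fun k => Real.sqrt 2 * brownian T.toNNReal (ω₀ k)) with hΨdef
  have htoLp : ∀ t : ℝ≥0, Measurable fun ω₀ : Fin 3 → (ℝ≥0 → ℝ) =>
      WithLp.toLp 2 (fun k => Real.sqrt 2 * brownian t (ω₀ k)) := fun t =>
    (WithLp.measurable_toLp 2 _).comp (measurable_pi_lambda _ fun k =>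
      ((measurable_brownian t).const_mul _).comp (measurable_pi_apply k))
  have hΨm : Measurable Ψ := (htoLp _).sub (htoLp _)
  set Φ : (Fin 3 → (ℝ≥0 → ℝ)) → ℝ≥0∞ := fun ω₀ => ENNReal.ofReal (Real.exp (a' * ‖Ψ ω₀‖))
    with hΦdef
  have hΦm : Measurable Φ := (hΨm.norm.const_mul a').exp.ennreal_ofReal
  have hdiff : ∀ (M : ℕ) (X : Config (M + 1)) (ω : PathSpace (M + 1)),
      worldLine X ω (T + τ).toNNReal 0 - worldLine X ω T.toNNReal 0 = Ψ (ω 0) := fun M X ω =>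
    add_sub_add_left_eq_sub _ _ _
  -- the one-line observable in `Config 1` form
  set e : Config 1 → ℝ≥0∞ := fun d => ENNReal.ofReal (Real.exp (a' * ‖d 0‖)) with hedef
  have hem : Measurable e := ((measurable_pi_apply 0).norm.const_mul a').exp.ennreal_ofReal
  -- Step 1: factorise the `(n+1)`-line functional and the normaliser
  have hfac := lintegral_fkWeight_free_mul_apply_zero n L (2 * T) hΦm
  have hfac1 := lintegral_fkWeight_free_mul_apply_zero n L (2 * T)
    (measurable_const : Measurable fun _ : Fin 3 → (ℝ≥0 → ℝ) => (1 : ℝ≥0∞))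
  set G₁ : ℝ≥0∞ := ∫⁻ x : Space, ∫⁻ ω₀, fkWeight (N := 1) (fun _ => 0) L (2 * T) (fun _ => x)
    (fun _ => ω₀) * Φ ω₀ ∂wienerLine with hG₁
  set Θ₁ : ℝ≥0∞ := ∫⁻ x : Space, ∫⁻ ω₀, fkWeight (N := 1) (fun _ => 0) L (2 * T) (fun _ => x)
    (fun _ => ω₀) ∂wienerLine with hΘ₁
  set Bn : ℝ≥0∞ := ∫⁻ Y : Config n, ∫⁻ ωb, fkWeight (fun _ => 0) L (2 * T) Y ωb ∂wienerPaths n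
    with hBn
  simp only [mul_one] at hfac1
  have hLHS : ∫⁻ X₀ : Config (n + 1), ∫⁻ ω, fkWeight (fun _ => 0) L (2 * T) X₀ ω *
      ENNReal.ofReal (Real.exp (a / Real.sqrt (τ + 1) *
        ‖worldLine X₀ ω (T + τ).toNNReal 0 - worldLine X₀ ω T.toNNReal 0‖)) ∂wienerPaths (n + 1) =
      G₁ * Bn := by
    rw [← hfac]
    refine lintegral_congr fun X₀ => lintegral_congr fun ω => ?_
    rw [hdiff n X₀ ω]
  have hN : fkNormSq (N := n + 1) (fun _ => 0) L T (fun _ => (1 : ℝ≥0∞)) = Θ₁ * Bn := by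
    rw [fkNormSq_eq_lintegral_fkWeight measurable_const L hT0 measurable_const]
    simp only [one_mul, mul_one]
    exact hfac1
  have hZ1 : fkNormSq (N := 1) (fun _ => 0) L T (fun _ => (1 : ℝ≥0∞)) = Θ₁ := by
    rw [fkNormSq_eq_lintegral_fkWeight measurable_const L hT0 measurable_const]
    simp only [one_mul, mul_one]
    have h := lintegral_config_one_pathSpace_one L (2 * T) (fun _ => (1 : ℝ≥0∞))
    simp only [mul_one] at h
    exact h
  have hG1 : G₁ = ∫⁻ X : Config 1, ∫⁻ ω, fkWeight (fun _ => 0) L (2 * T) X ω *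
      e (worldLine X ω (T + τ).toNNReal - worldLine X ω T.toNNReal) ∂wienerPaths 1 := by
    rw [hG₁, ← lintegral_config_one_pathSpace_one L (2 * T) Φ]
    refine lintegral_congr fun X => lintegral_congr fun ω => ?_
    simp only [hedef, hΦdef, Pi.sub_apply, hdiff 0 X ω]
  -- Step 2: the cross-cut bound for one line, the Gaussian constant, the ladder
  have hcc := crossCut_le (N := 1) (measurable_const : Measurable fun _ : ℝ => (0 : ℝ≥0∞)) L hτ0
    hτT hem
  have hM : ∫⁻ ω, e (displacement τ.toNNReal ω) ∂wienerPaths 1 ≤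
      ENNReal.ofReal (6 * Real.exp (9 * a ^ 2)) := by
    refine (lintegral_exp_mul_norm_displacement_le (N := 1) 0 ha'0 τ.toNNReal).trans
      (ENNReal.ofReal_le_ofReal ?_)
    rw [Real.coe_toNNReal _ hτ0]
    exact mul_le_mul_of_nonneg_left (Real.exp_le_exp.2 ha'2) (by norm_num)
  have hlad := fkNormSq_one_sub_le (T := T) hLpos hτ0 hτT h4τ
  obtain ⟨Z, hZdef⟩ : ∃ Z : ℝ≥0∞, Z = fkNormSq (N := 1) (fun _ => 0) L T (fun _ => (1 : ℝ≥0∞)) :=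
    ⟨_, rfl⟩
  obtain ⟨r, hrdef⟩ : ∃ r : ℝ≥0∞, r = ENNReal.ofReal (8 / (1 - 6 * Real.exp (-5))) := ⟨_, rfl⟩
  rw [← hZdef] at hlad hcc hZ1
  rw [← hrdef] at hlad
  have hr1 : 1 ≤ r := by
    rw [hrdef, ENNReal.one_le_ofReal, le_div_iff₀ hq₀pos]
    have : Real.exp (-5) ≤ 1 := Real.exp_le_one_iff.2 (by norm_num)
    nlinarith [Real.exp_pos (-5)]
  have hsq : fkNormSq (N := 1) (fun _ => 0) L (T - τ) (fun _ => (1 : ℝ≥0∞)) ^ (1 / 2 : ℝ) *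
      Z ^ (1 / 2 : ℝ) ≤ r * Z := by
    have hhalf : (Z ^ (2 : ℝ)) ^ (1 / 2 : ℝ) = Z := by
      rw [← ENNReal.rpow_mul]; norm_num
    calc fkNormSq (N := 1) (fun _ => 0) L (T - τ) (fun _ => (1 : ℝ≥0∞)) ^ (1 / 2 : ℝ) * Z ^ (1 / 2 : ℝ)
        ≤ (r * Z) ^ (1 / 2 : ℝ) * Z ^ (1 / 2 : ℝ) :=
          mul_le_mul' (ENNReal.rpow_le_rpow hlad (by norm_num)) le_rfl
      _ = r ^ (1 / 2 : ℝ) * (Z ^ (2 : ℝ)) ^ (1 / 2 : ℝ) := by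
          rw [← ENNReal.mul_rpow_of_nonneg _ _ (by norm_num : (0 : ℝ) ≤ 1 / 2), mul_assoc,
            ENNReal.mul_rpow_of_nonneg _ _ (by norm_num : (0 : ℝ) ≤ 1 / 2), ENNReal.rpow_two, sq]
      _ = r ^ (1 / 2 : ℝ) * Z := by rw [hhalf]
      _ ≤ r * Z := by
          refine mul_le_mul' ?_ le_rfl
          have h := ENNReal.rpow_le_rpow_of_exponent_le hr1 (by norm_num : (1 / 2 : ℝ) ≤ 1)
          rwa [ENNReal.rpow_one] at h
  have hG1le : G₁ ≤ ENNReal.ofReal (6 * Real.exp (9 * a ^ 2)) * (r * Z) := by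
    rw [hG1]
    exact hcc.trans (mul_le_mul' hM hsq)
  -- Step 3: assemble the constants
  have hC : 6 * Real.exp (9 * a ^ 2) * (8 / (1 - 6 * Real.exp (-5))) ≤
      max (48 / (1 - 6 * Real.exp (-5))) 9 * Real.exp (max (48 / (1 - 6 * Real.exp (-5))) 9 * a ^ 2) := by
    have h1 : 6 * Real.exp (9 * a ^ 2) * (8 / (1 - 6 * Real.exp (-5))) =
        48 / (1 - 6 * Real.exp (-5)) * Real.exp (9 * a ^ 2) := by ring
    rw [h1]
    refine mul_le_mul (le_max_left _ _) (Real.exp_le_exp.2 ?_) (Real.exp_pos _).le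
      (le_trans (by positivity) (le_max_left _ _))
    exact mul_le_mul_of_nonneg_right (le_max_right _ _) (sq_nonneg a)
  calc ∫⁻ X₀ : Config (n + 1), ∫⁻ ω, fkWeight (fun _ => 0) L (2 * T) X₀ ω *
        ENNReal.ofReal (Real.exp (a / Real.sqrt (τ + 1) *
          ‖worldLine X₀ ω (T + τ).toNNReal 0 - worldLine X₀ ω T.toNNReal 0‖)) ∂wienerPaths (n + 1)
      = G₁ * Bn := hLHS
    _ ≤ ENNReal.ofReal (6 * Real.exp (9 * a ^ 2)) * (r * Z) * Bn := mul_le_mul' hG1le le_rfl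
    _ = ENNReal.ofReal (6 * Real.exp (9 * a ^ 2) * (8 / (1 - 6 * Real.exp (-5)))) * (Θ₁ * Bn) := by
        conv_rhs => rw [ENNReal.ofReal_mul' (div_pos (by norm_num) hq₀pos).le]
        rw [← hrdef, ← hZ1]
        ring
    _ ≤ ENNReal.ofReal (max (48 / (1 - 6 * Real.exp (-5))) 9 *
          Real.exp (max (48 / (1 - 6 * Real.exp (-5))) 9 * a ^ 2)) *
          fkNormSq (N := n + 1) (fun _ => 0) L T (fun _ => (1 : ℝ≥0∞)) := by
        rw [hN]
        exact mul_le_mul' (ENNReal.ofReal_le_ofReal hC) le_rfl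

/-- Registered toolbox stub `stub_taggedDisplacementFree` (lead a1, from worker W5): the FREE-GAS
row `v ≡ 0` of `TaggedDisplacementMoments` (= `taggedDisplacement_free`). -/
theorem stub_taggedDisplacementFree : ∀ (κ a : ℝ), 0 < κ → 0 ≤ a →
    ∃ ρ₀ : ℝ, 0 < ρ₀ ∧ ∀ ρ : ℝ, 0 < ρ → ρ < ρ₀ → ∃ C : ℝ, 0 < C ∧ ∀ᶠ n : ℕ in atTop,
      ∀ T : ℝ, κ / ρ ≤ T → ∀ τ : ℝ, 0 ≤ τ → τ ≤ κ / ρ →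
        ∫⁻ X₀ : Config (n + 1), ∫⁻ ω,
            fkWeight (fun _ => 0) (sideLength ρ (n + 1)) (2 * T) X₀ ω *
              ENNReal.ofReal (Real.exp (a / Real.sqrt (τ + 1) *
                ‖worldLine X₀ ω (T + τ).toNNReal 0 - worldLine X₀ ω T.toNNReal 0‖))
          ∂wienerPaths (n + 1) ≤
        ENNReal.ofReal (C * Real.exp (C * a ^ 2)) *
          fkNormSq (N := n + 1) (fun _ => 0) (sideLength ρ (n + 1)) T (fun _ => (1 : ℝ≥0∞)) :=
  fun κ a hκ ha => taggedDisplacement_free κ a hκ ha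

end TaggedDisplacement

end Summit.AtomisticToContinuum.BoseEinsteinCondensation.Cruxes.TwoReplicaTransienceBound.TaggedShiftLogHarnack

end
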